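import Mathlib
import Summits.ABC.ABC.Theses.RibetTakahashiSplit
import Literature.Barriers.ABC.BakerMethodBoundsYuInput

/-!
# Sketch (crux-ideate stmt-ABC-15149, ideator 1, round 1) — calibration statements only, no idea card

Typed forms of the two calibration notes of `CalibrationIdeator1R1.md`:

* `BakerEntropyRung` — BN2: Pasten arXiv:1705.09251 Prop 15.1 / §15.2 with Yu 2007's constant:
  `log T(E) ≤ log N + A·ω(N)²·(1 + log log N) + A` on the Frey class (entropy exponent 1 in the regime
  ω(N)² loglog N = o(log N)); to be vendored as a Literature fact / Theorems rung from
  `Literature.Barriers.ABC.yu2007_padicLogForm_rat`, NOT a crux lever.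
* `LucasRadicalAllPowers` — BN1: `rad(2^{12k} − 1) > (12k)^A` for all primes `k ≥ k₀(A)` (few-log
  Matveev + `q ≡ 1 (mod 2k)` pinning); corrects the G1 benchmark of BarrierNotesIdeator3 §V2-B.
-/

namespace Summit.ABC.ABC.Cruxes.ManyPrimeValuationProductFrey.Ideator1

open Real

/-- The valuation product of the route, `T(W) = ∏_{p ∣ N, p² ∤ N} ord_p Δ_min`. -/
noncomputable def valProd (W : WeierstrassCurve ℚ) : ℕ :=
  ∏ p ∈ (W.conductorNorm ℤ).primeFactors with ¬ p ^ 2 ∣ W.conductorNorm ℤ,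
    (W.minimalDiscriminantNorm ℤ).factorization p

/-- BN2 (typed): the Baker entropy rung on the Frey class — a consequence of Yu 2007 summed in log
space (Pasten 1705.09251 Prop 15.1/§15.2); stated as a Prop to be proved from
`Literature.Barriers.ABC.yu2007_padicLogForm_rat`. -/
def BakerEntropyRung : Prop :=
  ∃ A : ℝ, 0 < A ∧ ∀ (W : WeierstrassCurve ℚ) [W.IsElliptic],
    (∃ (a b d : ℤ) (C' : WeierstrassCurve.VariableChange ℚ), IsCoprime a b ∧ a * b * (a + b) ≠ 0 ∧
      d ∣ 2 ∧ C' • W = Literature.NumberTheory.EllipticCurves.freyCurve (d * a) (d * b)) →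
    Real.log (valProd W) ≤ Real.log (W.conductorNorm ℤ) +
      A * ((W.conductorNorm ℤ).primeFactors.card : ℝ) ^ 2 *
        (1 + Real.log (max 1 (Real.log (W.conductorNorm ℤ)))) + A

/-- The rung gives entropy exponent `1 + ε` whenever `ω(N)² · loglog N ≤ (ε/A) log N` (bookkeeping only). -/
def BakerEntropyRungConsequence : Prop :=
  BakerEntropyRung → ∀ ε : ℝ, 0 < ε → ∃ C δ : ℝ, 0 < δ ∧ ∀ (W : WeierstrassCurve ℚ) [W.IsElliptic],
    (∃ (a b d : ℤ) (C' : WeierstrassCurve.VariableChange ℚ), IsCoprime a b ∧ a * b * (a + b) ≠ 0 ∧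
      d ∣ 2 ∧ C' • W = Literature.NumberTheory.EllipticCurves.freyCurve (d * a) (d * b)) →
    ((W.conductorNorm ℤ).primeFactors.card : ℝ) ^ 2 * Real.log (max 1 (Real.log (W.conductorNorm ℤ)))
        ≤ δ * Real.log (W.conductorNorm ℤ) →
    (valProd W : ℝ) ≤ C * ((W.conductorNorm ℤ : ℕ) : ℝ) ^ (1 + ε)

/-- BN1 (typed): the Lucas benchmark R_A holds for every `A` (few-log Matveev + Zsigmondy pinning). -/
def LucasRadicalAllPowers : Prop :=
  ∀ A : ℕ, ∃ k₀ : ℕ, ∀ k : ℕ, k.Prime → k₀ ≤ k →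
    (12 * k) ^ A < UniqueFactorizationMonoid.radical (2 ^ (12 * k) - 1)

/-- Arithmetic input of BN1, checkable: `2^12 − 1 = 3² · 5 · 7 · 13`. -/
example : 2 ^ 12 - 1 = 3 ^ 2 * 5 * 7 * 13 := by norm_num

/-- Pinning input of BN1: a prime `q ∉ {3,5,7,13}` dividing `2^(12k) − 1` (k prime) has `k ∣ q − 1`,
because `orderOf (2 : ZMod q) ∣ 12k` and `∤ 12`. Stated; proof is elementary (`ZMod.pow_card_sub_one_eq_one`,
`orderOf_dvd_iff_pow_eq_one`). -/
def LucasPinning : Prop :=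
  ∀ k q : ℕ, k.Prime → q.Prime → q ∣ 2 ^ (12 * k) - 1 → q ∉ ({3, 5, 7, 13} : Finset ℕ) → k ∣ q - 1

end Summit.ABC.ABC.Cruxes.ManyPrimeValuationProductFrey.Ideator1
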